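import Mathlib
import HarnessLib
import Literature.Computability.AlgebraicComplexity.PatternExpressions
import Summits.ValiantsHypothesis.ValiantsHypothesis.Theorems.MonotoneRestorationOrbitCompressionQPOneRowFromFamily

/-!
# Route MonotoneRestoration — aside `OrbitCompressionQP` (stmt-ValiantsHypothesis-18332), line
# `expression_compression`: TRANSPOSITION — the conclusion class of `stub_narrowExpressionCompression` is
# closed under `x_ij ↦ x_ji`, and the one-COLUMN stratum

Everything proved for rows holds for columns: a pattern expression with `k` row and `l` column labels has a
transpose with `l` row and `k` column labels, of the same length, whose value at `(γ, ρ)` is the original value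
at `(ρ, γ)` with the variables transposed.

* `exists_transpose` (values), `exists_close_transpose` (closed polynomials);
* `narrowQP_transpose` — `NQP(f) ⇒ NQP(n ↦ fᵀ_n)`, `fᵀ_n = rename Prod.swap f_n`;
* ★ `narrowQP_oneCol_of_family_VP` — the one-COLUMN stratum `f_n = Σ_j g_n(col j)` (`g_n` symmetric,
  `f ∈ VP`) of the stub, from the one-row stratum (`narrowQP_oneRow_of_family_VQP`) by transposition
  (`VQP` is invariant under renaming along the involution `Prod.swap`).

Helper file (`--supports stmt-ValiantsHypothesis-18332`); def-free; nothing here is a named fact; no registered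
stub is closed; VP ≠ VNP is not moved.
-/

noncomputable section

open MvPolynomial

-- `Summit.ValiantsHypothesis.ValiantsHypothesis.…` is the tree's single-conjunct layout (Sub = Summit).
set_option linter.dupNamespace false

namespace Summit.ValiantsHypothesis.ValiantsHypothesis.Theorems

namespace FormulaSubstitution

open Literature.Computability.AlgebraicComplexity

section SingleLevel

variable {F : Type} [CommSemiring F] {k l : ℕ}

/-- **Transpose of an expression, values**: same length, labels swapped, value = the transposed value.
[folklore] -/
theorem exists_transpose (n : ℕ) :
    ∀ e : PatternExpr F k l, ∃ e' : PatternExpr F l k, e'.length = e.length ∧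
      ∀ (γ : Fin l → Fin n) (ρ : Fin k → Fin n),
        e'.value n γ ρ = rename Prod.swap (e.value n ρ γ) := by
  intro e
  induction e with
  | edge a b => exact ⟨PatternExpr.edge b a, rfl, fun γ ρ => by simp⟩
  | const c => exact ⟨PatternExpr.const c, rfl, fun γ ρ => by simp⟩
  | add e₁ e₂ ih₁ ih₂ =>
    obtain ⟨e₁', h₁, hv₁⟩ := ih₁
    obtain ⟨e₂', h₂, hv₂⟩ := ih₂
    exact ⟨PatternExpr.add e₁' e₂', by simp [PatternExpr.length, h₁, h₂],
      fun γ ρ => by simp [hv₁, hv₂]⟩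
  | mul e₁ e₂ ih₁ ih₂ =>
    obtain ⟨e₁', h₁, hv₁⟩ := ih₁
    obtain ⟨e₂', h₂, hv₂⟩ := ih₂
    exact ⟨PatternExpr.mul e₁' e₂', by simp [PatternExpr.length, h₁, h₂],
      fun γ ρ => by simp [hv₁, hv₂]⟩
  | sumRow a e ih =>
    obtain ⟨e', h, hv⟩ := ih
    exact ⟨PatternExpr.sumCol a e', by simp [PatternExpr.length, h],
      fun γ ρ => by simp [hv, map_sum]⟩
  | sumCol b e ih =>
    obtain ⟨e', h, hv⟩ := ih
    exact ⟨PatternExpr.sumRow b e', by simp [PatternExpr.length, h],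
      fun γ ρ => by simp [hv, map_sum]⟩

/-- **Transpose of an expression, closed polynomials**: `close e' = rename Prod.swap (close e)`. [folklore] -/
theorem exists_close_transpose (n : ℕ) (e : PatternExpr F k l) :
    ∃ e' : PatternExpr F l k, e'.length = e.length ∧ e'.close n = rename Prod.swap (e.close n) := by
  obtain ⟨e', hl, hv⟩ := exists_transpose n e
  refine ⟨e', hl, ?_⟩
  rw [PatternExpr.close, PatternExpr.close, map_sum, Finset.sum_comm]
  simp only [map_sum, hv]

end SingleLevel

section Family

/-- **`NQP` is closed under transposition** `x_ij ↦ x_ji`. [folklore] -/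
theorem narrowQP_transpose (f : (n : ℕ) → MvPolynomial (Fin n × Fin n) ℂ)
    (hf : ∃ c : ℕ, ∀ n : ℕ, 1 ≤ n → ∃ (k l : ℕ) (e : PatternExpr ℂ k l),
      n ^ (k + l) ≤ 2 ^ ((Nat.log 2 n + c) ^ c) ∧ e.length ≤ 2 ^ ((Nat.log 2 n + c) ^ c) ∧
      e.close n = f n) :
    ∃ c : ℕ, ∀ n : ℕ, 1 ≤ n → ∃ (k l : ℕ) (e : PatternExpr ℂ k l),
      n ^ (k + l) ≤ 2 ^ ((Nat.log 2 n + c) ^ c) ∧ e.length ≤ 2 ^ ((Nat.log 2 n + c) ^ c) ∧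
      e.close n = rename Prod.swap (f n) := by
  obtain ⟨c, hc⟩ := hf
  refine ⟨c, fun n hn => ?_⟩
  obtain ⟨k, l, e, hkl, hlen, hclose⟩ := hc n hn
  obtain ⟨e', hl', hc'⟩ := exists_close_transpose n e
  exact ⟨l, k, e', by rwa [add_comm], by rw [hl']; exact hlen, by rw [hc', hclose]⟩

/-- Transposing the one-column family gives the one-row family. [folklore] -/
theorem rename_swap_oneCol {n : ℕ} (g : MvPolynomial (Fin n) ℂ) :
    rename Prod.swap (∑ j : Fin n, aeval (fun v : Fin n => (X (v, j) : MvPolynomial (Fin n × Fin n) ℂ)) g) =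
      ∑ i : Fin n, aeval (fun v : Fin n => (X (i, v) : MvPolynomial (Fin n × Fin n) ℂ)) g := by
  rw [map_sum]
  refine Finset.sum_congr rfl fun j _ => ?_
  rw [← AlgHom.comp_apply, comp_aeval]
  have hfun : (fun v : Fin n => rename Prod.swap (X (v, j) : MvPolynomial (Fin n × Fin n) ℂ)) =
      fun v : Fin n => (X (j, v) : MvPolynomial (Fin n × Fin n) ℂ) := funext fun v => by rw [rename_X]; rfl
  rw [hfun]

/-- Transposing the one-row family gives the one-column family. [folklore] -/
theorem rename_swap_oneRow {n : ℕ} (g : MvPolynomial (Fin n) ℂ) :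
    rename Prod.swap (∑ i : Fin n, aeval (fun v : Fin n => (X (i, v) : MvPolynomial (Fin n × Fin n) ℂ)) g) =
      ∑ j : Fin n, aeval (fun v : Fin n => (X (v, j) : MvPolynomial (Fin n × Fin n) ℂ)) g := by
  rw [map_sum]
  refine Finset.sum_congr rfl fun i _ => ?_
  rw [← AlgHom.comp_apply, comp_aeval]
  have hfun : (fun v : Fin n => rename Prod.swap (X (i, v) : MvPolynomial (Fin n × Fin n) ℂ)) =
      fun v : Fin n => (X (v, i) : MvPolynomial (Fin n × Fin n) ℂ) := funext fun v => by rw [rename_X]; rfl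
  rw [hfun]

/-- `VQP` is invariant under transposition of the variable matrix. [folklore] -/
theorem isVQPFamily_transpose (f : (n : ℕ) → MvPolynomial (Fin n × Fin n) ℂ) (hf : IsVQPFamily f) :
    IsVQPFamily fun n => rename Prod.swap (f n) := by
  obtain ⟨⟨hcard, hdeg⟩, hL⟩ := hf
  exact ⟨⟨hcard, hdeg.mono fun n => totalDegree_rename_le _ _⟩,
    hL.mono fun n => complexity_rename_le_holds' _ _⟩

/-- ★ **The one-COLUMN stratum of `stub_narrowExpressionCompression`**: for symmetric `g_n`, if
`f_n = Σ_j g_n(x_{0,j}, …, x_{n-1,j})` is `VQP` then `f` is narrow of quasi-polynomial length.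
[cite: BlaserJindal2019, Thm. 4] -/
theorem narrowQP_oneCol_of_family_VQP (g : (n : ℕ) → MvPolynomial (Fin n) ℂ)
    (hsymm : ∀ n, (g n).IsSymmetric)
    (hf : IsVQPFamily fun n =>
      ∑ j : Fin n, aeval (fun v : Fin n => (X (v, j) : MvPolynomial (Fin n × Fin n) ℂ)) (g n)) :
    ∃ c : ℕ, ∀ n : ℕ, 1 ≤ n → ∃ (k l : ℕ) (e : PatternExpr ℂ k l),
      n ^ (k + l) ≤ 2 ^ ((Nat.log 2 n + c) ^ c) ∧ e.length ≤ 2 ^ ((Nat.log 2 n + c) ^ c) ∧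
      e.close n = ∑ j : Fin n,
        aeval (fun v : Fin n => (X (v, j) : MvPolynomial (Fin n × Fin n) ℂ)) (g n) := by
  have hrow : IsVQPFamily fun n =>
      ∑ i : Fin n, aeval (fun v : Fin n => (X (i, v) : MvPolynomial (Fin n × Fin n) ℂ)) (g n) := by
    have h := isVQPFamily_transpose _ hf
    refine ⟨⟨h.1.1, h.1.2.mono fun n => ?_⟩, h.2.mono fun n => ?_⟩
    · simp only [rename_swap_oneCol]; exact le_rfl
    · simp only [rename_swap_oneCol]; exact le_rfl
  obtain ⟨c, hc⟩ := narrowQP_transpose _ (narrowQP_oneRow_of_family_VQP g hsymm hrow)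
  refine ⟨c, fun n hn => ?_⟩
  obtain ⟨k, l, e, hkl, hlen, hclose⟩ := hc n hn
  exact ⟨k, l, e, hkl, hlen, by rw [hclose, rename_swap_oneRow]⟩

/-- The `VP` case of the one-column stratum. [cite: BlaserJindal2019, Thm. 4] -/
theorem narrowQP_oneCol_of_family_VP (g : (n : ℕ) → MvPolynomial (Fin n) ℂ)
    (hsymm : ∀ n, (g n).IsSymmetric)
    (hf : IsVPFamily fun n =>
      ∑ j : Fin n, aeval (fun v : Fin n => (X (v, j) : MvPolynomial (Fin n × Fin n) ℂ)) (g n)) :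
    ∃ c : ℕ, ∀ n : ℕ, 1 ≤ n → ∃ (k l : ℕ) (e : PatternExpr ℂ k l),
      n ^ (k + l) ≤ 2 ^ ((Nat.log 2 n + c) ^ c) ∧ e.length ≤ 2 ^ ((Nat.log 2 n + c) ^ c) ∧
      e.close n = ∑ j : Fin n,
        aeval (fun v : Fin n => (X (v, j) : MvPolynomial (Fin n × Fin n) ℂ)) (g n) :=
  narrowQP_oneCol_of_family_VQP g hsymm hf.isVQPFamily

end Family

end FormulaSubstitution

end Summit.ValiantsHypothesis.ValiantsHypothesis.Theorems

end
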